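import Literature.AnabelianGeometry.Anabelioids.ImageExactProofs
import Literature.AnabelianGeometry.SemiGraphs.GraphOfAnabelioids

/-!
# The semi-graph of image anabelioids of a morphism ([SemiAnbd] Remark 2.3.1, p. 25)

Mochizuki, *Semi-graphs of anabelioids*, Publ. RIMS **42** (2006), Remark 2.3.1
[cite: MochizukiSemiAnbd2006, Rem. 2.3.1 p.25]: "by replacing the constituent anabelioids of `𝒢'`
by the image anabelioids [cf. [Mzk8], Definition 1.1.7 (i)] of the constituent anabelioids of `𝒢`,
one may always take the approximator of Definition 2.3, (iii), to be `π₁`-epimorphic."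

This DEFINITION file supplies the construction behind that sentence, for an arbitrary morphism
of semi-graphs of anabelioids `φ₀ : 𝒢 → 𝒢₀`:

* `Anabelioids.Hom.toImage φ : X → I_φ` — the factor of a morphism of connected anabelioids
  `φ : X → Y` through its image anabelioid `I_φ ⊆ X` ([GeoAn] Def. 1.1.7 (i), p. 14; tree:
  `Anabelioids.Image φ.pullback`, a Galois category by `image_galoisCategory_holds`); its pull-back
  functor is the inclusion `ι`, exact by `ImageExactProofs`;
* `Anabelioids.Hom.restrictToImage` — the restriction of a morphism `ψ : X' → X` to `I_φ`, landing
  in a full subcategory of `X'` containing the objects `ψ^* A`, `A ∈ I_φ`;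
* `SemiGraphOfAnabelioids.Hom.imageAnabelioids φ₀` — the semi-graph of anabelioids with underlying
  semi-graph that of `𝒢`, constituents the image anabelioids `I_{φ₀,v} ⊆ 𝒢_v`, `I_{φ₀,e} ⊆ 𝒢_e`, and
  `b_*` the restrictions of those of `𝒢` (they map `I_{φ₀,v}` into `I_{φ₀,e}` by the 2-isomorphisms
  `(φ₀)_b`, `Hom.imageObj_pull_obj`);
* `SemiGraphOfAnabelioids.Hom.toImageAnabelioids φ₀ : 𝒢 → φ₀.imageAnabelioids` — identity on the
  underlying semi-graph, the factors `𝒢_v → I_{φ₀,v}` on constituents, identity 2-cells.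

That `toImageAnabelioids` of an approximator is a `π₁`-epimorphic approximator splitting the same
coverings (the named fact `remark_2_3_1`) is proved in `ApproximatorImageProofs.lean`.
-/

namespace Literature.AnabelianGeometry.Anabelioids

open CategoryTheory CategoryTheory.Limits

universe v₁ v₂ v₃ v₄ u₁ u₂ u₃ u₄

section Lift

variable {C : Type u₁} [Category.{v₁} C] {D : Type u₂} [Category.{v₂} D] (P : ObjectProperty D)
  (F : C ⥤ D) (hF : ∀ A, P (F.obj A))

/-- A finite-limit-preserving functor lifted to a full subcategory of its target still preserves
finite limits (the inclusion reflects them). [folklore] -/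
private theorem preservesFiniteLimits_lift [PreservesFiniteLimits F] :
    PreservesFiniteLimits (P.lift F hF) := by
  refine ⟨fun J _ _ => ?_⟩
  haveI : PreservesLimitsOfShape J (P.lift F hF ⋙ P.ι) :=
    preservesLimitsOfShape_of_natIso (P.liftCompιIso F hF).symm
  exact preservesLimitsOfShape_of_reflects_of_preserves (P.lift F hF) P.ι

/-- A finite-colimit-preserving functor lifted to a full subcategory of its target still preserves
finite colimits (the inclusion reflects them). [folklore] -/
private theorem preservesFiniteColimits_lift [PreservesFiniteColimits F] :
    PreservesFiniteColimits (P.lift F hF) := by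
  refine ⟨fun J _ _ => ?_⟩
  haveI : PreservesColimitsOfShape J (P.lift F hF ⋙ P.ι) :=
    preservesColimitsOfShape_of_natIso (P.liftCompιIso F hF).symm
  exact preservesColimitsOfShape_of_reflects_of_preserves (P.lift F hF) P.ι

end Lift

section ToImage

variable {X : Type u₁} [Category.{v₁} X] {Y : Type u₂} [Category.{v₂} Y] [GaloisCategory X]
  [GaloisCategory Y] (φ : Hom X Y)

/-- `I_φ` is a connected anabelioid ([GeoAn] p. 14; instance form of the proved named fact
`image_galoisCategory`). [cite: MochizukiGeoAn2004, §1.1 p.14] -/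
instance galoisCategory_image : GaloisCategory (Image φ.pullback) :=
  image_galoisCategory_holds X Y φ

/-- The inclusion `ι : I_φ ⥤ X` preserves finite limits (instance form).
[cite: MochizukiGeoAn2004, §1.1 p.14] -/
instance preservesFiniteLimits_imageι' : PreservesFiniteLimits (imageObj φ.pullback).ι :=
  preservesFiniteLimits_imageι φ

/-- The inclusion `ι : I_φ ⥤ X` preserves finite colimits (instance form).
[cite: MochizukiGeoAn2004, §1.1 p.14] -/
instance preservesFiniteColimits_imageι' : PreservesFiniteColimits (imageObj φ.pullback).ι :=
  preservesFiniteColimits_imageι φ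

/-- The morphism of connected anabelioids `X → I_φ` through which `φ : X → Y` factors ([GeoAn]
p. 14, "`X → I_φ → Y`"): its pull-back functor is the (exact) inclusion `ι : I_φ ⥤ X`.
[cite: MochizukiGeoAn2004, §1.1 p.14] -/
noncomputable def Hom.toImage : Hom X (Image φ.pullback) :=
  ExactFunctor.of (imageObj φ.pullback).ι

/-- The pull-back functor of `X → I_φ` is the inclusion. [cite: MochizukiGeoAn2004, §1.1 p.14] -/
@[simp] theorem Hom.toImage_pullback : (Hom.toImage φ).pullback = (imageObj φ.pullback).ι := rfl

end ToImage

section Restrict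

variable {X : Type u₁} [Category.{v₁} X] {Y : Type u₂} [Category.{v₂} Y]
  {X' : Type u₃} [Category.{v₃} X'] {Y' : Type u₄} [Category.{v₄} Y']

/-- Subquotients of objects `P B` are carried to subquotients of objects `P' B'` by any functor `R`
preserving monomorphisms and epimorphisms that 2-commutes with `P`, `P'`: `P ⋙ R ≅ Q ⋙ P'`.
[cite: MochizukiGeoAn2004, Def. 1.1.7(i) p.14] -/
theorem imageObj_obj_of_iso (P : Y ⥤ X) (P' : Y' ⥤ X') (R : X ⥤ X') [R.PreservesMonomorphisms]
    [R.PreservesEpimorphisms] (Q : Y ⥤ Y') (e : P ⋙ R ≅ Q ⋙ P') {A : X}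
    (hA : imageObj P A) : imageObj P' (R.obj A) := by
  obtain ⟨B, S, i, q, hi, hq⟩ := hA
  refine ⟨Q.obj B, R.obj S, R.map i ≫ (e.app B).hom, R.map q, ?_, inferInstance⟩
  exact mono_comp _ _

variable [GaloisCategory X] [GaloisCategory Y]

/-- **Restriction of a morphism of anabelioids to an image anabelioid**: for `ψ : X' → X` (exact
`ψ^* : X ⥤ X'`), `φ : X → Y`, and a full subcategory `P' ⊆ X'` containing the objects `ψ^* A`,
`A ∈ I_φ`, the induced morphism `P' → I_φ` with pull-back functor `ψ^*|_{I_φ} : I_φ ⥤ P'` (exact: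
`ι ⋙ ψ^*` is exact and the inclusion of `P'` reflects finite (co)limits).
[cite: MochizukiSemiAnbd2006, Rem. 2.3.1 p.25] -/
noncomputable def Hom.restrictToImage (ψ : Hom X' X) (φ : Hom X Y) (P' : ObjectProperty X')
    (h : ∀ A : X, imageObj φ.pullback A → P' (ψ.pullback.obj A)) :
    Hom P'.FullSubcategory (Image φ.pullback) :=
  haveI : PreservesFiniteLimits ((imageObj φ.pullback).ι ⋙ ψ.pullback) :=
    comp_preservesFiniteLimits _ _
  haveI : PreservesFiniteColimits ((imageObj φ.pullback).ι ⋙ ψ.pullback) :=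
    comp_preservesFiniteColimits _ _
  haveI := preservesFiniteLimits_lift P' ((imageObj φ.pullback).ι ⋙ ψ.pullback)
    fun A => h A.obj A.property
  haveI := preservesFiniteColimits_lift P' ((imageObj φ.pullback).ι ⋙ ψ.pullback)
    fun A => h A.obj A.property
  ExactFunctor.of (P'.lift ((imageObj φ.pullback).ι ⋙ ψ.pullback) fun A => h A.obj A.property)

/-- The pull-back functor of the restriction is the lift of `ι ⋙ ψ^*`.
[cite: MochizukiSemiAnbd2006, Rem. 2.3.1 p.25] -/
theorem Hom.restrictToImage_pullback (ψ : Hom X' X) (φ : Hom X Y) (P' : ObjectProperty X')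
    (h : ∀ A : X, imageObj φ.pullback A → P' (ψ.pullback.obj A)) :
    (Hom.restrictToImage ψ φ P' h).pullback =
      P'.lift ((imageObj φ.pullback).ι ⋙ ψ.pullback) fun A => h A.obj A.property := rfl

/-- The restriction followed by the inclusion of `P'` is the inclusion of `I_φ` followed by `ψ^*`
(definitionally). [cite: MochizukiSemiAnbd2006, Rem. 2.3.1 p.25] -/
theorem Hom.restrictToImage_pullback_comp_ι (ψ : Hom X' X) (φ : Hom X Y) (P' : ObjectProperty X')
    (h : ∀ A : X, imageObj φ.pullback A → P' (ψ.pullback.obj A)) :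
    (Hom.restrictToImage ψ φ P' h).pullback ⋙ P'.ι = (imageObj φ.pullback).ι ⋙ ψ.pullback := rfl

end Restrict

end Literature.AnabelianGeometry.Anabelioids

namespace Literature.AnabelianGeometry.SemiGraphs

open CategoryTheory CategoryTheory.Limits
open Literature.AnabelianGeometry.Anabelioids

universe v₁ u₁ u

namespace SemiGraphOfAnabelioids

variable {𝒢 𝒢₀ : SemiGraphOfAnabelioids.{v₁, u₁, u}} (φ₀ : Hom 𝒢 𝒢₀)

/-- The image property of an edge component does not depend on how its target edge is indexed.
[cite: MochizukiSemiAnbd2006, Rem. 2.4.2 p.26] -/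
theorem Hom.imageObj_φE_eq (e : 𝒢.graph.Edge) (f : 𝒢₀.graph.Edge) (hf : φ₀.base.edgeMap e = f) :
    imageObj (φ₀.φE e f hf).pullback = imageObj (φ₀.φE e (φ₀.base.edgeMap e) rfl).pullback := by
  subst hf
  rfl

/-- The functors `b^* : 𝒢_v ⥤ 𝒢_e` carry the image anabelioid `I_{φ₀,v} ⊆ 𝒢_v` into
`I_{φ₀,e} ⊆ 𝒢_e` (transport of subquotients along the 2-isomorphism `(φ₀)_b`).
[cite: MochizukiSemiAnbd2006, Rem. 2.3.1 p.25] -/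
theorem Hom.imageObj_pull_obj (b : 𝒢.graph.Branch) (v : 𝒢.graph.Vertex)
    (h : 𝒢.graph.abuts b = some v) {A : 𝒢.V v} (hA : imageObj (φ₀.φV v).pullback A) :
    imageObj (φ₀.φE (𝒢.graph.edgeOf b) (φ₀.base.edgeMap (𝒢.graph.edgeOf b)) rfl).pullback
      ((𝒢.pull b v h).pullback.obj A) := by
  rw [← φ₀.imageObj_φE_eq (𝒢.graph.edgeOf b) (𝒢₀.graph.edgeOf (φ₀.base.branchMap b))
    (φ₀.base.edgeOf_branchMap b).symm]
  exact imageObj_obj_of_iso _ _ (𝒢.pull b v h).pullback _ (φ₀.φB b v h) hA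

/-- **The semi-graph of image anabelioids of `φ₀ : 𝒢 → 𝒢₀`** ([SemiAnbd] Remark 2.3.1: "replacing
the constituent anabelioids … by the image anabelioids"): underlying semi-graph that of `𝒢`,
constituents `I_{φ₀,v} ⊆ 𝒢_v` and `I_{φ₀,e} ⊆ 𝒢_e`, and `b_*` the restrictions of the `b_*` of `𝒢`.
[cite: MochizukiSemiAnbd2006, Rem. 2.3.1 p.25] -/
noncomputable def Hom.imageAnabelioids : SemiGraphOfAnabelioids.{v₁, u₁, u} where
  graph := 𝒢.graph
  V v := Image (φ₀.φV v).pullback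
  E e := Image (φ₀.φE e (φ₀.base.edgeMap e) rfl).pullback
  pull b v h := Hom.restrictToImage (𝒢.pull b v h) (φ₀.φV v) _
    fun _ hA => φ₀.imageObj_pull_obj b v h hA

/-- The underlying semi-graph of the semi-graph of image anabelioids is that of `𝒢`.
[cite: MochizukiSemiAnbd2006, Rem. 2.3.1 p.25] -/
@[simp] theorem Hom.imageAnabelioids_graph : φ₀.imageAnabelioids.graph = 𝒢.graph := rfl

/-- The vertex constituents are the image anabelioids `I_{φ₀,v}`.
[cite: MochizukiSemiAnbd2006, Rem. 2.3.1 p.25] -/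
theorem Hom.imageAnabelioids_V (v : 𝒢.graph.Vertex) :
    φ₀.imageAnabelioids.V v = Image (φ₀.φV v).pullback := rfl

/-- The edge constituents are the image anabelioids `I_{φ₀,e}`.
[cite: MochizukiSemiAnbd2006, Rem. 2.3.1 p.25] -/
theorem Hom.imageAnabelioids_E (e : 𝒢.graph.Edge) :
    φ₀.imageAnabelioids.E e = Image (φ₀.φE e (φ₀.base.edgeMap e) rfl).pullback := rfl

/-- The `b^*` of the semi-graph of image anabelioids, followed by the inclusion `I_{φ₀,e} ⊆ 𝒢_e`, is
the inclusion `I_{φ₀,v} ⊆ 𝒢_v` followed by the `b^*` of `𝒢` (definitionally).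
[cite: MochizukiSemiAnbd2006, Rem. 2.3.1 p.25] -/
theorem Hom.imageAnabelioids_pull_comp_ι (b : 𝒢.graph.Branch) (v : 𝒢.graph.Vertex)
    (h : 𝒢.graph.abuts b = some v) :
    (φ₀.imageAnabelioids.pull b v h).pullback ⋙ (imageObj _).ι =
      (imageObj (φ₀.φV v).pullback).ι ⋙ (𝒢.pull b v h).pullback := rfl

/-- On objects, the `b^*` of the semi-graph of image anabelioids is the `b^*` of `𝒢`.
[cite: MochizukiSemiAnbd2006, Rem. 2.3.1 p.25] -/
@[simp] theorem Hom.imageAnabelioids_pull_obj (b : 𝒢.graph.Branch) (v : 𝒢.graph.Vertex)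
    (h : 𝒢.graph.abuts b = some v) (A : φ₀.imageAnabelioids.V v) :
    ((φ₀.imageAnabelioids.pull b v h).pullback.obj A).obj = (𝒢.pull b v h).pullback.obj A.obj :=
  rfl

/-- On morphisms, the `b^*` of the semi-graph of image anabelioids is the `b^*` of `𝒢`.
[cite: MochizukiSemiAnbd2006, Rem. 2.3.1 p.25] -/
@[simp] theorem Hom.imageAnabelioids_pull_map (b : 𝒢.graph.Branch) (v : 𝒢.graph.Vertex)
    (h : 𝒢.graph.abuts b = some v) {A A' : φ₀.imageAnabelioids.V v} (f : A ⟶ A') :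
    ((φ₀.imageAnabelioids.pull b v h).pullback.map f).hom =
      (𝒢.pull b v h).pullback.map f.hom :=
  rfl

/-- **The morphism `𝒢 → φ₀.imageAnabelioids`**: the identity on the underlying semi-graph, the
factors `𝒢_v → I_{φ₀,v}`, `𝒢_e → I_{φ₀,e}` (pull-back functor the inclusion) on constituents, and
identity 2-isomorphisms. [cite: MochizukiSemiAnbd2006, Rem. 2.3.1 p.25] -/
noncomputable def Hom.toImageAnabelioids : Hom 𝒢 φ₀.imageAnabelioids where
  base := 𝟙 𝒢.graph
  φV v := Hom.toImage (φ₀.φV v)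
  φE e f hf := by
    subst hf
    exact Hom.toImage (φ₀.φE e (φ₀.base.edgeMap e) rfl)
  φB _ _ _ := Iso.refl _

/-- `𝒢 → φ₀.imageAnabelioids` lies over the identity of `𝔾`. [cite: MochizukiSemiAnbd2006, Rem. 2.3.1 p.25] -/
@[simp] theorem Hom.toImageAnabelioids_base : φ₀.toImageAnabelioids.base = 𝟙 𝒢.graph := rfl

/-- The vertex components of `𝒢 → φ₀.imageAnabelioids` are the factors `𝒢_v → I_{φ₀,v}`.
[cite: MochizukiSemiAnbd2006, Rem. 2.3.1 p.25] -/
@[simp] theorem Hom.toImageAnabelioids_φV (v : 𝒢.graph.Vertex) :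
    φ₀.toImageAnabelioids.φV v = Hom.toImage (φ₀.φV v) := rfl

/-- The edge components of `𝒢 → φ₀.imageAnabelioids` are the factors `𝒢_e → I_{φ₀,e}`.
[cite: MochizukiSemiAnbd2006, Rem. 2.3.1 p.25] -/
@[simp] theorem Hom.toImageAnabelioids_φE (e : 𝒢.graph.Edge) :
    φ₀.toImageAnabelioids.φE e (φ₀.toImageAnabelioids.base.edgeMap e) rfl =
      Hom.toImage (φ₀.φE e (φ₀.base.edgeMap e) rfl) := rfl

end SemiGraphOfAnabelioids

end Literature.AnabelianGeometry.SemiGraphs
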